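import Summits.Ventures.LatticeQCDFlow.Exactness.IMHCommonRandomNumbersSharp
import HarnessLib

/-!
# Stochastic monotonicity of flow-MCMC in the importance weight: under common random numbers a lighter run stays
# lighter forever, so from a heavier start the law of `w(X_n)` is stochastically larger at every time — the cold run
# dominates every run

HONEST FRAMING: exact (Metropolis-corrected) sampling algorithms for lattice gauge theory;
figures of merit are autocorrelation/cost numbers at stated couplings and volumes; no
continuum-physics claim.

Venture `LatticeQCDFlow` (cell pub-lqcd), topic `Exactness`; FANOUT row 30 (lean-1, GEN-36).  NEW WORK of the
cell, general state space.  `Exactness/IMHCommonRandomNumbers` proved that the common-random-numbers update is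
MONOTONE IN THE WEIGHT ORDER (`crnPair_weightOrder`: from `w(x′) ≤ w(x)` the pair kernel `K̂` charges only
`{w(p₂) ≤ w(p₁)}`).  Here the order is propagated through time and read on the marginals, which are the two runs
(`Exactness/IMHCommonRandomNumbersSharp.iterate_bind_crnPair_map_fst/snd`):

* §1 **`bind_crnPair_weightOrder`**, **`iterate_bind_crnPair_weightOrder`** — if the initial coupling charges only
  ordered pairs (`μ̂₀{w(p₂) ≤ w(p₁)} = 1`) then so does `μ̂₀K̂ⁿ` for every `n`: A LIGHTER RUN STAYS LIGHTER FOREVER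
  under shared random numbers (it accepts whenever the heavier one does, and then both sit at the same configuration).
* §2 **`integral_iterate_bind_indepMH_mono_of_weight_le`** — STOCHASTIC MONOTONICITY OF THE SAMPLER ITSELF (a
  statement about `K` alone, proved through the coupling): for `w(x′) ≤ w(x)`, every monotone bounded measurable
  `h : ℝ → ℝ` and every `n`: `E_{x′}[h(w(X_n))] ≤ E_x[h(w(X_n))]` — from a heavier start the importance weight is
  stochastically larger at every time; in particular (**`integral_iterate_bind_indepMH_mode_dominates`**) THE COLD
  RUN (started at the mode `x₀`) DOMINATES EVERY RUN: `E_{x}[h(w(X_n))] ≤ E_{x₀}[h(w(X_n))]` for all `x`.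
Reading (gauge files): the exact gauge samplers' kernel weight is maximal at the cold configuration; a run started
anywhere carries, at every time, a stochastically smaller weight than the cold-started run — every weight-monotone
diagnostic (e.g. the frozen-plaquette product outside the block) is worst from the cold start, pathwise under
shared random numbers and in law without them.
NOT CLAIMED: monotonicity for observables that are not functions of the weight; strict inequalities.
No `sorry`, no new definitions, nothing cited as a fact.
-/

noncomputable section

namespace Summit.Ventures.LatticeQCDFlow.Exactness

open MeasureTheory ProbabilityTheory Function Set
open scoped ENNReal unitInterval

variable {Ω : Type*} [MeasurableSpace Ω] {q : Measure Ω} [IsProbabilityMeasure q] {w : Ω → ℝ}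

/-! ## §1 The weight order is preserved forever -/

/-- **ONE SHARED UPDATE PRESERVES THE WEIGHT ORDER IN LAW**: if `m{w(p₂) ≤ w(p₁)} = 1` then `(m K̂){w(p₂) ≤ w(p₁)} = 1`.
[ours] -/
theorem bind_crnPair_weightOrder (hw : Measurable w) (hw0 : ∀ y, 0 < w y) (Khat : Kernel (Ω × Ω) (Ω × Ω))
    [IsMarkovKernel Khat]
    (hK : ∀ z : Ω × Ω, Khat z = (q.prod (volume : Measure unitInterval)).map (fun p : Ω × unitInterval =>
      ((if (p.2 : ℝ) * w z.1 ≤ w p.1 then p.1 else z.1), (if (p.2 : ℝ) * w z.2 ≤ w p.1 then p.1 else z.2))))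
    (m : Measure (Ω × Ω)) [IsProbabilityMeasure m] (hm : m {p : Ω × Ω | w p.2 ≤ w p.1} = 1) :
    (m.bind Khat) {p : Ω × Ω | w p.2 ≤ w p.1} = 1 := by
  have hO : MeasurableSet {p : Ω × Ω | w p.2 ≤ w p.1} :=
    measurableSet_le (hw.comp measurable_snd) (hw.comp measurable_fst)
  haveI : IsProbabilityMeasure (m.bind Khat) :=
    ⟨by rw [Measure.bind_apply MeasurableSet.univ (Kernel.aemeasurable _)]; simp⟩
  refine le_antisymm prob_le_one ?_
  rw [Measure.bind_apply hO (Kernel.aemeasurable _)]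
  calc (1 : ℝ≥0∞) = m {p : Ω × Ω | w p.2 ≤ w p.1} := hm.symm
    _ = ∫⁻ z in {p : Ω × Ω | w p.2 ≤ w p.1}, 1 ∂m := by rw [setLIntegral_const, one_mul]
    _ = ∫⁻ z in {p : Ω × Ω | w p.2 ≤ w p.1}, Khat z {p : Ω × Ω | w p.2 ≤ w p.1} ∂m := by
        refine setLIntegral_congr_fun hO (fun z hz => ?_)
        exact (crnPair_weightOrder hw hw0 Khat hK hz).symm
    _ ≤ ∫⁻ z, Khat z {p : Ω × Ω | w p.2 ≤ w p.1} ∂m := setLIntegral_le_lintegral _ _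

/-- **A LIGHTER RUN STAYS LIGHTER FOREVER**: if the initial coupling charges only ordered pairs, so does `μ̂₀K̂ⁿ` for
every `n`. [ours] -/
theorem iterate_bind_crnPair_weightOrder (hw : Measurable w) (hw0 : ∀ y, 0 < w y) (Khat : Kernel (Ω × Ω) (Ω × Ω))
    [IsMarkovKernel Khat]
    (hK : ∀ z : Ω × Ω, Khat z = (q.prod (volume : Measure unitInterval)).map (fun p : Ω × unitInterval =>
      ((if (p.2 : ℝ) * w z.1 ≤ w p.1 then p.1 else z.1), (if (p.2 : ℝ) * w z.2 ≤ w p.1 then p.1 else z.2)))) :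
    ∀ (n : ℕ) (m : Measure (Ω × Ω)) [IsProbabilityMeasure m], m {p : Ω × Ω | w p.2 ≤ w p.1} = 1 →
      ((fun μ : Measure (Ω × Ω) => μ.bind Khat)^[n] m) {p : Ω × Ω | w p.2 ≤ w p.1} = 1
  | 0, m, _, hm => hm
  | n + 1, m, _, hm => by
    haveI : IsProbabilityMeasure (m.bind Khat) :=
      ⟨by rw [Measure.bind_apply MeasurableSet.univ (Kernel.aemeasurable _)]; simp⟩
    rw [Function.iterate_succ_apply]
    exact iterate_bind_crnPair_weightOrder hw hw0 Khat hK n (m.bind Khat) (bind_crnPair_weightOrder hw hw0 Khat hK m hm)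

/-! ## §2 Stochastic monotonicity of the sampler in the weight -/

/-- **STOCHASTIC MONOTONICITY OF FLOW-MCMC IN THE IMPORTANCE WEIGHT.**  `w` measurable and positive.  If
`w(x′) ≤ w(x)` then for every monotone measurable `h : ℝ → ℝ` bounded by `C` and every `n`:
`∫ h(w y) Kⁿ(x′, dy) ≤ ∫ h(w y) Kⁿ(x, dy)` — from a heavier start the weight is stochastically larger at every time.
(Proved through the common-random-numbers coupling, whose marginals are the two runs.) [ours] -/
theorem integral_iterate_bind_indepMH_mono_of_weight_le (hw : Measurable w) (hw0 : ∀ y, 0 < w y) {x x' : Ω}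
    (hle : w x' ≤ w x) {h : ℝ → ℝ} (hh : Monotone h) (hhm : Measurable h) {C : ℝ} (hC : ∀ t, |h t| ≤ C) (n : ℕ) :
    ∫ y, h (w y) ∂((fun μ : Measure Ω => μ.bind (indepMH q w))^[n] (Measure.dirac x')) ≤
      ∫ y, h (w y) ∂((fun μ : Measure Ω => μ.bind (indepMH q w))^[n] (Measure.dirac x)) := by
  haveI : Fact (Measurable w) := ⟨hw⟩
  obtain ⟨Khat, hKm, hK⟩ := exists_crnPairKernel (q := q) hw
  haveI := hKm
  set m : Measure (Ω × Ω) := Measure.dirac (x, x') with hmdef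
  haveI hP : IsProbabilityMeasure ((fun μ : Measure (Ω × Ω) => μ.bind Khat)^[n] m) :=
    isProbabilityMeasure_iterate_bind (κ := Khat) m n
  set P : Measure (Ω × Ω) := (fun μ : Measure (Ω × Ω) => μ.bind Khat)^[n] m with hPdef
  have hO : MeasurableSet {p : Ω × Ω | w p.2 ≤ w p.1} :=
    measurableSet_le (hw.comp measurable_snd) (hw.comp measurable_fst)
  have hm1 : m {p : Ω × Ω | w p.2 ≤ w p.1} = 1 := by
    rw [hmdef, Measure.dirac_apply' _ hO, indicator_of_mem (by exact hle), Pi.one_apply]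
  have hPO : P {p : Ω × Ω | w p.2 ≤ w p.1} = 1 := iterate_bind_crnPair_weightOrder hw hw0 Khat hK n m hm1
  -- marginals of `P` are the two runs' laws
  have hfst : P.map Prod.fst = (fun μ : Measure Ω => μ.bind (indepMH q w))^[n] (Measure.dirac x) := by
    rw [hPdef, iterate_bind_crnPair_map_fst hw hw0 Khat hK n m, hmdef,
      Measure.map_dirac' measurable_fst]
  have hsnd : P.map Prod.snd = (fun μ : Measure Ω => μ.bind (indepMH q w))^[n] (Measure.dirac x') := by
    rw [hPdef, iterate_bind_crnPair_map_snd hw hw0 Khat hK n m, hmdef,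
      Measure.map_dirac' measurable_snd]
  have hgm : Measurable (fun y : Ω => h (w y)) := hhm.comp hw
  rw [← hfst, ← hsnd, integral_map measurable_snd.aemeasurable hgm.aestronglyMeasurable,
    integral_map measurable_fst.aemeasurable hgm.aestronglyMeasurable]
  -- pathwise order, almost surely
  have hae : ∀ᵐ p ∂P, h (w p.2) ≤ h (w p.1) := by
    have : ∀ᵐ p ∂P, p ∈ {p : Ω × Ω | w p.2 ≤ w p.1} := by
      rw [ae_iff]
      have : {p : Ω × Ω | ¬ p ∈ {p : Ω × Ω | w p.2 ≤ w p.1}} = {p : Ω × Ω | w p.2 ≤ w p.1}ᶜ := rfl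
      rw [this, prob_compl_eq_one_sub hO, hPO, tsub_self]
    filter_upwards [this] with p hp
    exact hh hp
  have hi1 : Integrable (fun p : Ω × Ω => h (w p.1)) P :=
    Summit.Ventures.LatticeQCDFlow.Scoring.integrable_of_bounded P (hgm.comp measurable_fst) (fun p => hC _)
  have hi2 : Integrable (fun p : Ω × Ω => h (w p.2)) P :=
    Summit.Ventures.LatticeQCDFlow.Scoring.integrable_of_bounded P (hgm.comp measurable_snd) (fun p => hC _)
  exact integral_mono_ae hi2 hi1 hae

/-- **THE COLD RUN DOMINATES EVERY RUN**: for `w` maximal at `x₀`, every monotone bounded measurable `h` and every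
start `x`: `∫ h(w y) Kⁿ(x, dy) ≤ ∫ h(w y) Kⁿ(x₀, dy)`. [ours] -/
theorem integral_iterate_bind_indepMH_mode_dominates (hw : Measurable w) (hw0 : ∀ y, 0 < w y) {x₀ : Ω}
    (hmax : ∀ y, w y ≤ w x₀) (x : Ω) {h : ℝ → ℝ} (hh : Monotone h) (hhm : Measurable h) {C : ℝ}
    (hC : ∀ t, |h t| ≤ C) (n : ℕ) :
    ∫ y, h (w y) ∂((fun μ : Measure Ω => μ.bind (indepMH q w))^[n] (Measure.dirac x)) ≤
      ∫ y, h (w y) ∂((fun μ : Measure Ω => μ.bind (indepMH q w))^[n] (Measure.dirac x₀)) :=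
  integral_iterate_bind_indepMH_mono_of_weight_le hw hw0 (hmax x) hh hhm hC n

end Summit.Ventures.LatticeQCDFlow.Exactness

end
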